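import Summits.NavierStokesRegularity.NavierStokesRegularity.Theorems.TypeIIInviscidRelaxationAxisymSwirlRegularZhangBarrierW
import Summits.NavierStokesRegularity.NavierStokesRegularity.Theorems.TypeIIInviscidRelaxationAxisymSwirlRegularPartialTypeIGate
import HarnessLib

/-!
# Crux `AxisymSwirlRegular` ⟺ an a-priori κ-ENVELOPE gate on the radial inflow near the axis (`κ ∈ (0,1]`)

Helper toward the crux `AxisymSwirlRegular` (stmt-NavierStokesRegularity-1964, route TypeIIInviscidRelaxation),
registered line `radial_inflow_split` (theorems only, no new definitions).

With the κ-inflow criterion unconditional (`hasSmoothExtensionPast_of_kappaEnvelope_holds`, explicit barrier of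
`…ZhangBarrierW`), the crux acquires a one-estimate currency for EVERY `κ ∈ (0,1]`, extending the `κ = 1` case
`axisymSwirlRegular_iff_aprioriPartialTypeI`:

* `kappaGate_of_bound` — a uniform bound `‖u‖ ≤ B` on `[0,T) × ℝ³` gives the gate
  `u_r ≥ −M ν^{1−κ/2} r^{κ−1}(T−t)^{−κ/2}` on the unit tube with `M = max B 0 · T^{κ/2}/ν^{1−κ/2}`
  (`r^{κ−1} ≥ 1` for `r ≤ 1`, `(T−t)^{−κ/2} ≥ T^{−κ/2}`).
* `axisymSwirlRegular_iff_aprioriKappaGate` — for each fixed `κ ∈ (0,1]`: `AxisymSwirlRegular` holds iff every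
  solution of the standing axisymmetric class (classical on `[0,T)`, Leray–Hopf on `[0,T]` from a rapidly decaying
  datum, bounded on closed sub-slabs, axisymmetric slices) admits SOME `M` with the κ-gate on `{0 < r ≤ 1} × [0,T)`.

Reading: the open content of ⟨1964⟩ is, equivalently for each `κ ∈ (0,1]`, the a-priori exclusion of inflow
`u_r < −M r^{κ−1}(T−t)^{−κ/2}` for every `M` along `t ↑ T` in the unit tube — a one-parameter family of currencies
between the critical `r^{−1}` envelope of ⟨19059⟩/⟨19060⟩ (`κ = 0`, constant tied to `C < 2`) and Zhang's
`(T−t)^{−1/2}` (`κ = 1`), all with a FREE constant.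

References: Qi S. Zhang, arXiv:2604.07785 (2026) [Zhang2026PartialTypeI]. [new]
-/

noncomputable section

open Set Filter Topology Real
open Literature.Analysis.FluidPDE

namespace Summit.NavierStokesRegularity.NavierStokesRegularity.Theorems

set_option linter.dupNamespace false

open Summit.NavierStokesRegularity.NavierStokesRegularity.Theses.TypeIIInviscidRelaxation (AxisymSwirlRegular)

/-- A uniform bound `‖u‖ ≤ B` on `[0,T) × ℝ³` gives the κ-gate on the unit tube with
`M = max B 0 · T^{κ/2} / ν^{1−κ/2}`. [new] -/
theorem kappaGate_of_bound {κ ν T B : ℝ} (hκ0 : 0 < κ) (hκ1 : κ ≤ 1) (hν : 0 < ν) (hT : 0 < T)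
    {u : ℝ → EuclideanSpace ℝ (Fin 3) → EuclideanSpace ℝ (Fin 3)}
    (hB : ∀ t ∈ Ico 0 T, ∀ x, ‖u t x‖ ≤ B) :
    ∃ M : ℝ, ∀ t ∈ Ico 0 T, ∀ x : EuclideanSpace ℝ (Fin 3), 0 < cylRadius x → cylRadius x ≤ 1 →
      -(M * ν ^ (1 - κ / 2) * cylRadius x ^ (κ - 1) * (T - t) ^ (-(κ / 2))) ≤ radialVelocity (u t) x := by
  refine ⟨max B 0 * T ^ (κ / 2) / ν ^ (1 - κ / 2), fun t ht x hx hx1 => ?_⟩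
  have hs : 0 < T - t := by linarith [ht.2]
  have hν' : 0 < ν ^ (1 - κ / 2) := rpow_pos_of_pos hν _
  have hTk : 0 < T ^ (κ / 2) := rpow_pos_of_pos hT _
  have h1 : -‖u t x‖ ≤ radialVelocity (u t) x := neg_norm_le_radialVelocity (u t) x
  have h2 : ‖u t x‖ ≤ max B 0 := (hB t ht x).trans (le_max_left _ _)
  -- `r^{κ−1} ≥ 1` and `(T−t)^{−κ/2} ≥ T^{−κ/2}`
  have hr : 1 ≤ cylRadius x ^ (κ - 1) := one_le_rpow_of_pos_of_le_one_of_nonpos hx hx1 (by linarith)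
  have hst : T ^ (-(κ / 2)) ≤ (T - t) ^ (-(κ / 2)) :=
    rpow_le_rpow_of_nonpos hs (by linarith [ht.1]) (by linarith [hκ0.le])
  have hTT : T ^ (κ / 2) * T ^ (-(κ / 2)) = 1 := by
    rw [rpow_neg hT.le, mul_inv_cancel₀ hTk.ne']
  have hM0 : 0 ≤ max B 0 * T ^ (κ / 2) / ν ^ (1 - κ / 2) * ν ^ (1 - κ / 2) := by positivity
  have h3 : max B 0 ≤ max B 0 * T ^ (κ / 2) / ν ^ (1 - κ / 2) * ν ^ (1 - κ / 2)
      * cylRadius x ^ (κ - 1) * (T - t) ^ (-(κ / 2)) := by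
    have e : max B 0 * T ^ (κ / 2) / ν ^ (1 - κ / 2) * ν ^ (1 - κ / 2) = max B 0 * T ^ (κ / 2) := by
      field_simp
    rw [e]
    have hT0 : 0 ≤ T ^ (-(κ / 2)) := rpow_nonneg hT.le _
    calc max B 0 = max B 0 * T ^ (κ / 2) * 1 * T ^ (-(κ / 2)) := by
          rw [mul_one, mul_assoc, hTT, mul_one]
      _ ≤ max B 0 * T ^ (κ / 2) * cylRadius x ^ (κ - 1) * (T - t) ^ (-(κ / 2)) := by
          apply mul_le_mul _ hst hT0 (by positivity)
          exact mul_le_mul_of_nonneg_left hr (by positivity)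
  linarith

/-- **The crux ⟺ an a-priori κ-gate on the unit tube**, for each fixed `κ ∈ (0,1]`.  `←`: the unconditional
κ-inflow criterion `hasSmoothExtensionPast_of_kappaEnvelope_holds` (enlarging `M` to `max M 1 > 0`) and
`axisymSwirlRegular_of_noBlowup`; `→`: boundedness up to `T` under the crux
(`hasSmoothExtensionPast_and_bounded_of_axisymSwirlRegular`) and `kappaGate_of_bound`. [new] -/
theorem axisymSwirlRegular_iff_aprioriKappaGate {κ : ℝ} (hκ0 : 0 < κ) (hκ1 : κ ≤ 1) :
    AxisymSwirlRegular ↔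
      ∀ (ν T : ℝ), 0 < ν → 0 < T →
        ∀ (u : ℝ → EuclideanSpace ℝ (Fin 3) → EuclideanSpace ℝ (Fin 3))
          (p : ℝ → EuclideanSpace ℝ (Fin 3) → ℝ),
          IsClassicalNSSolutionOn (Ico 0 T) ν 0 u p → IsLerayHopfOn T ν 0 (u 0) u →
          (∀ T' < T, ∃ M : ℝ, ∀ t ∈ Icc 0 T', ∀ x, ‖u t x‖ ≤ M) →
          (∀ t ∈ Ico 0 T, IsAxisymmetric (u t)) → HasRapidSpatialDecay (u 0) →
          ∃ M : ℝ, ∀ t ∈ Ico 0 T, ∀ x : EuclideanSpace ℝ (Fin 3), 0 < cylRadius x → cylRadius x ≤ 1 →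
            -(M * ν ^ (1 - κ / 2) * cylRadius x ^ (κ - 1) * (T - t) ^ (-(κ / 2))) ≤ radialVelocity (u t) x := by
  constructor
  · intro hAX ν T hν hT u p hcl hLH _hbd hax hdec
    obtain ⟨-, B, hB⟩ := hasSmoothExtensionPast_and_bounded_of_axisymSwirlRegular hAX hν hT hcl hLH
      (hax 0 (left_mem_Ico.2 hT)) hdec
    exact kappaGate_of_bound hκ0 hκ1 hν hT hB
  · intro hK
    refine axisymSwirlRegular_of_noBlowup fun ν T hν hT u p hcl hLH hbd hax hdec => ?_
    obtain ⟨M, hM⟩ := hK ν T hν hT u p hcl hLH hbd hax hdec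
    have hM' : ∀ t ∈ Ico 0 T, ∀ x : EuclideanSpace ℝ (Fin 3), 0 < cylRadius x → cylRadius x ≤ 1 →
        -((max M 1) * ν ^ (1 - κ / 2) * cylRadius x ^ (κ - 1) * (T - t) ^ (-(κ / 2)))
          ≤ radialVelocity (u t) x := by
      intro t ht x hx hx1
      have h1 := hM t ht x hx hx1
      have hfac : 0 ≤ ν ^ (1 - κ / 2) * cylRadius x ^ (κ - 1) * (T - t) ^ (-(κ / 2)) := by
        have hs : 0 < T - t := by linarith [ht.2]
        have := rpow_pos_of_pos hν (1 - κ / 2)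
        have := rpow_pos_of_pos hx (κ - 1)
        have := rpow_pos_of_pos hs (-(κ / 2))
        positivity
      have h2 : M * (ν ^ (1 - κ / 2) * cylRadius x ^ (κ - 1) * (T - t) ^ (-(κ / 2)))
          ≤ max M 1 * (ν ^ (1 - κ / 2) * cylRadius x ^ (κ - 1) * (T - t) ^ (-(κ / 2))) :=
        mul_le_mul_of_nonneg_right (le_max_left _ _) hfac
      have e1 : M * ν ^ (1 - κ / 2) * cylRadius x ^ (κ - 1) * (T - t) ^ (-(κ / 2))
          = M * (ν ^ (1 - κ / 2) * cylRadius x ^ (κ - 1) * (T - t) ^ (-(κ / 2))) := by ring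
      have e2 : max M 1 * ν ^ (1 - κ / 2) * cylRadius x ^ (κ - 1) * (T - t) ^ (-(κ / 2))
          = max M 1 * (ν ^ (1 - κ / 2) * cylRadius x ^ (κ - 1) * (T - t) ^ (-(κ / 2))) := by ring
      rw [e2]; rw [e1] at h1; linarith
    exact hasSmoothExtensionPast_of_kappaEnvelope_holds hκ0 hκ1 (lt_of_lt_of_le one_pos (le_max_right M 1))
      hν hT hcl hLH hdec hax hM'

end Summit.NavierStokesRegularity.NavierStokesRegularity.Theorems

end
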